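import Literature.AnabelianGeometry.EtaleTheta.SettingModelTateThetaCuspOncePunctured
import Literature.AnabelianGeometry.EtaleTheta.SettingModelTateCensusClauses
import Literature.AnabelianGeometry.EtaleTheta.Discharge.Sec1CompletionAutInvolution
import Literature.AnabelianGeometry.EtaleTheta.Discharge.Sec2InvEllOfCLevel
import Literature.AnabelianGeometry.EtaleTheta.Discharge.Sec2InertiaBinderOfHat
import Mathlib.Topology.Instances.ZMod
import HarnessLib

/-!
# [EtTh] §2 at the STAGE-2 cusped model `modelχq′`: the profinite `Π_C := Π_X ⋊_{ι̂} ℤ/2` for the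
# cocycle-corrected inversion — a `PiCData` inhabitant at which hιell / hιtheta HOLD (consumer form) and
# hIx FAILS (stage-2 twin of `SettingModelChiPiC`; NV record for GAP-LEDGER G-L2t10-4 / G-L2t10-3)

S. Mochizuki, *The étale theta function and its Frobenioid-theoretic manifestations*, Publ. RIMS **45**
(2009) [EtTh], §2 p. 36 (printed 262): «`C^log` … the stack-theoretic quotient of `X^log` by the action of
`ι`», «`Π_C` … the (profinite) étale fundamental group of `C^log`», «`Gal(X/C) ≅ ℤ/2ℤ`»; Prop. 2.2 (i) p. 37
(«eigenvalues `−1` and `1`»); Def. 2.1 preamble p. 35 («`I_x ⊆ D_x` isomorphically onto `Δ̄_Θ`»)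
[cite: MochizukiEtTh2009, Def 2.1 p.36].

Cell abc-iut, layer L2, seat abc-iut-L2-t10 (gen 5; CLAIM 10:34Z). STAGE 2 of the R78 cluster (integrator
abc-iut-L6-d6): the carriers `curveχq′ p i j` (abc-iut-w5-d249, `SettingModelTateCusp`), the cusped setting
`ThetaSetting.modelχq′ p i j hj` (abc-iut-L2-t5, `SettingModelTateThetaCusp`) with its once-punctured parameters
(`nonempty_oncePuncturedData_modelχq'`, `SettingModelTateThetaCuspOncePunctured`), and the COCYCLE-CORRECTED
inversion `inversionχq p i j` (`SettingModelTateInversion`, p436210), whose completion `ι̂` has no closed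
formula — so, unlike the stage-1 file, `ι̂` is taken as `TemperedCurve.completionAut` itself and handled through
this seat's generic `Discharge/Sec1CompletionAutInvolution` (p438130):

* `hatInvχq p i j : MulAut Π_X := (ι̂ := completionAut (inversionχq p i j))`, an involution
  (`completionAut_completionAut_of_involutive` + `inversionχq_inversionχq`), continuous, OVER `G_{ℚ_p}`
  (`augHat_completionAut_of_aug` + `augχq_inversionχq`); `hatInvActionχq : ℤ/2 →* Aut(Π_X)`;
  the carrier **`PiCχq p i j := Π_X ⋊_{ι̂} ℤ/2`** (induced profinite topology; instances on it only);
* **`piCDataχq' p i j hj : (ThetaSetting.modelχq′ p i j hj).PiCData (PiCχq p i j)`** (`incl := inl`,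
  `aug := lift augHat 1`, range `G_K`);
* THEOREMS (the EXACT binder shapes of `PiCData.coverDataAx`, every `e`): **`piCDataχq'_inv_ell`** (hιell from
  ONE `c₁ := ε = inr 1̄` by `PiCData.inv_ell_of_one`, `ε·inl d·ε⁻¹·inl d = inl(ι̂ d·d) ∈ inl(⁅Δ̂,Δ̂⁆⁻)` = the
  stage-2 (R1e′) clause `inversionχq_hinv'`, p437157), **`piCDataχq'_inv_theta`**, **`piCDataχq'_not_hIx`**
  (toral cusp: `not_inertiaClause_curveχq'` + `inertia_sup_barKer_iff_inertia` + `isCompact_cuspDecompχq`),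
  headline **`exists_piCData_inv_ell_inv_theta_not_hIx_χq`**.

HONEST LIMITS: semi-synthetic stage-2 model, consistency evidence only; this `Π_C` is the profinite semidirect
product, NOT a tempered `Π^tp_C` (no `MuTwoSetting`/`CLevelData` — abc-iut-L6-d6's stage-2 map); class (b)
construction under the DEFS-FREEZE (no interface clause touched, no `Prop` fact); nothing of [EtTh] is
asserted; no side is taken on [IUTchIII] Cor. 3.12; typed ≠ proved.
-/

noncomputable section

namespace Literature.AnabelianGeometry.EtaleTheta.SettingModel

open scoped commutatorElement
open Literature.AnabelianGeometry.SemiGraphs _root_.Topology _root_.Function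

variable (p : ℕ) [Fact p.Prime] (i j : ℤ)

/-! ## §1. `ι̂ := completionAut (inversionχq)` and the carrier `Π_C := Π_X ⋊_{ι̂} ℤ/2` -/

/-- **`ι̂ ∈ Aut(Π_X)`**, the completion of the cocycle-corrected stage-2 inversion. [cite: MochizukiEtTh2009, §2 p.36] -/
def hatInvχq : MulAut (PiHtχq p i j) :=
  ((curveχq' p i j).completionAut (inversionχq p i j)).toMulEquiv

/-- [cite: MochizukiEtTh2009, §2 p.36] -/
theorem hatInvχq_apply (z : PiHtχq p i j) :
    hatInvχq p i j z = (curveχq' p i j).completionAut (inversionχq p i j) z := rfl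

/-- `ι̂` is an involution (`ι` is: `inversionχq_inversionχq`). [cite: MochizukiEtTh2009, §2 p.36] -/
@[simp] theorem hatInvχq_hatInvχq (z : PiHtχq p i j) : hatInvχq p i j (hatInvχq p i j z) = z :=
  (curveχq' p i j).completionAut_completionAut_of_involutive (inversionχq p i j) (inversionχq_inversionχq p i j) z

/-- `ι̂ · ι̂ = 1`. [cite: MochizukiEtTh2009, §2 p.36] -/
theorem hatInvχq_mul_hatInvχq : hatInvχq p i j * hatInvχq p i j = 1 := MulEquiv.ext fun z => hatInvχq_hatInvχq p i j z

/-- `ι̂` is continuous. [cite: MochizukiEtTh2009, §2 p.36] -/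
theorem continuous_hatInvχq : Continuous (hatInvχq p i j) :=
  ((curveχq' p i j).completionAut (inversionχq p i j)).continuous

/-- `ι̂` is over `G_{ℚ_p}` (`ι` is: `augχq_inversionχq`). [cite: Mochizuki2012, Rmk 1.4.1 (ii) p.28] -/
theorem augHatχq_hatInvχq (z : PiHtχq p i j) : augHatχq p i j (hatInvχq p i j z) = augHatχq p i j z :=
  (curveχq' p i j).augHat_completionAut_of_aug (inversionχq p i j) (augχq_inversionχq p i j) z

/-- On the dense part: `ι̂ (toHat x) = toHat (ι x)`. [cite: MochizukiEtTh2009, §2 p.36] -/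
theorem hatInvχq_toHat (x : PiTpχq p i j) : hatInvχq p i j (toHatχq p i j x) = toHatχq p i j (inversionχq p i j x) :=
  (curveχq' p i j).completionAut_toHat (inversionχq p i j) x

/-- **The action `ℤ/2 → Aut(Π_X)`, generator `↦ ι̂`.** [cite: MochizukiEtTh2009, §2 p.36] -/
def hatInvActionχq : Multiplicative (ZMod 2) →* MulAut (PiHtχq p i j) where
  toFun z := if z = 1 then 1 else hatInvχq p i j
  map_one' := if_pos rfl
  map_mul' a b := by
    have key : ∀ z : Multiplicative (ZMod 2), z = 1 ∨ z = Multiplicative.ofAdd 1 := by decide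
    have hne : (Multiplicative.ofAdd (1 : ZMod 2)) ≠ 1 := by decide
    have hsq : Multiplicative.ofAdd (1 : ZMod 2) * Multiplicative.ofAdd 1 = 1 := by decide
    rcases key a with rfl | rfl <;> rcases key b with rfl | rfl
    · simp
    · simp [hne]
    · simp [hne]
    · rw [hsq, if_pos rfl, if_neg hne, hatInvχq_mul_hatInvχq]

/-- The generator acts by `ι̂`. [cite: MochizukiEtTh2009, §2 p.36] -/
theorem hatInvActionχq_ofAdd_one : hatInvActionχq p i j (Multiplicative.ofAdd 1) = hatInvχq p i j := by
  change (if Multiplicative.ofAdd (1 : ZMod 2) = 1 then (1 : MulAut (PiHtχq p i j)) else hatInvχq p i j) = _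
  rw [if_neg (by decide)]

/-- Every `φ(z)` is `1` or `ι̂`. [cite: MochizukiEtTh2009, §2 p.36] -/
theorem hatInvActionχq_eq_one_or (z : Multiplicative (ZMod 2)) :
    hatInvActionχq p i j z = 1 ∨ hatInvActionχq p i j z = hatInvχq p i j := by
  have key : ∀ z : Multiplicative (ZMod 2), z = 1 ∨ z = Multiplicative.ofAdd 1 := by decide
  rcases key z with rfl | rfl
  · exact Or.inl (map_one _)
  · exact Or.inr (hatInvActionχq_ofAdd_one p i j)

/-- `augHat (φ(z) x) = augHat x`. [cite: Mochizuki2012, Rmk 1.4.1 (ii) p.28] -/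
theorem augHatχq_hatInvActionχq (z : Multiplicative (ZMod 2)) (x : PiHtχq p i j) :
    augHatχq p i j (hatInvActionχq p i j z x) = augHatχq p i j x := by
  rcases hatInvActionχq_eq_one_or p i j z with h | h <;> rw [h]
  · rfl
  · exact augHatχq_hatInvχq p i j x

/-- **`Π_C := Π_X ⋊_{ι̂} ℤ/2`** at stage 2 (type synonym; instances below live on it only).
[cite: MochizukiEtTh2009, Def 2.1 p.36] -/
abbrev PiCχq : Type := PiHtχq p i j ⋊[hatInvActionχq p i j] Multiplicative (ZMod 2)

/-- Induced topology along `g ↦ (g.left, g.right)`. [cite: MochizukiEtTh2009, Def 2.1 p.36] -/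
instance instTopologicalSpacePiCχq : TopologicalSpace (PiCχq p i j) :=
  TopologicalSpace.induced (fun g : PiCχq p i j => (g.left, g.right)) inferInstance

/-- [cite: MochizukiEtTh2009, Def 2.1 p.36] -/
theorem isInducing_leftRightCχq : IsInducing fun g : PiCχq p i j => (g.left, g.right) := ⟨rfl⟩

/-- The action map is jointly continuous (`ℤ/2` discrete, `ι̂` continuous). [cite: MochizukiEtTh2009, Def 2.1 p.36] -/
theorem continuous_hatInvActionχq_uncurry :
    Continuous fun q : Multiplicative (ZMod 2) × PiHtχq p i j => hatInvActionχq p i j q.1 q.2 := by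
  refine continuous_prod_of_discrete_left.mpr fun z => ?_
  rcases hatInvActionχq_eq_one_or p i j z with h | h
  · simp only [h, MulAut.one_apply]; exact continuous_id
  · simp only [h]; exact continuous_hatInvχq p i j

/-- `Π_C` is a topological group. [cite: MochizukiEtTh2009, Def 2.1 p.36] -/
instance instIsTopologicalGroupPiCχq : IsTopologicalGroup (PiCχq p i j) :=
  Semidirect.isTopologicalGroup_of_continuous_action (isInducing_leftRightCχq p i j)
    (continuous_hatInvActionχq_uncurry p i j)

/-- `Π_C` is compact. [cite: MochizukiEtTh2009, Def 2.1 p.36] -/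
instance instCompactSpacePiCχq : CompactSpace (PiCχq p i j) := Semidirect.compactSpace_of (isInducing_leftRightCχq p i j)

/-- `Π_C` is Hausdorff. [cite: MochizukiEtTh2009, Def 2.1 p.36] -/
instance instT2SpacePiCχq : T2Space (PiCχq p i j) := Semidirect.t2Space_of (isInducing_leftRightCχq p i j)

/-- `Π_C` is totally disconnected. [cite: MochizukiEtTh2009, Def 2.1 p.36] -/
instance instTotallyDisconnectedSpacePiCχq : TotallyDisconnectedSpace (PiCχq p i j) :=
  Semidirect.totallyDisconnectedSpace_of (isInducing_leftRightCχq p i j)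

/-- `augHat ∘ φ(z) = augHat` in the `SemidirectProduct.lift` shape. [cite: Mochizuki2012, Rmk 1.4.1 (ii) p.28] -/
theorem augHatχq_comp_hatInvActionχq (z : Multiplicative (ZMod 2)) :
    (augHatχq p i j).toMonoidHom.comp (hatInvActionχq p i j z).toMonoidHom =
      (MulAut.conj ((1 : Multiplicative (ZMod 2) →* GQp p) z)).toMonoidHom.comp (augHatχq p i j).toMonoidHom := by
  refine MonoidHom.ext fun x => ?_
  simp only [MonoidHom.comp_apply, MulEquiv.coe_toMonoidHom, MonoidHom.one_apply, map_one, MulAut.one_apply]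
  exact augHatχq_hatInvActionχq p i j z x

/-- **The augmentation `Π_C → G_{ℚ_p}`**, `(x, z) ↦ augHat x`. [cite: MochizukiEtTh2009, Def 2.1 p.36] -/
def augCχq : PiCχq p i j →ₜ* GQp p where
  toMonoidHom := SemidirectProduct.lift (augHatχq p i j).toMonoidHom 1 (augHatχq_comp_hatInvActionχq p i j)
  continuous_toFun := by
    change Continuous fun g : PiCχq p i j =>
      SemidirectProduct.lift (augHatχq p i j).toMonoidHom 1 (augHatχq_comp_hatInvActionχq p i j) g
    have h : (fun g : PiCχq p i j =>
        SemidirectProduct.lift (augHatχq p i j).toMonoidHom 1 (augHatχq_comp_hatInvActionχq p i j) g) =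
        fun g => augHatχq p i j g.left := by
      funext g
      change (augHatχq p i j).toMonoidHom g.left * (1 : Multiplicative (ZMod 2) →* GQp p) g.right = _
      rw [MonoidHom.one_apply, mul_one]
      rfl
    rw [h]
    exact (augHatχq p i j).continuous.comp (Semidirect.continuous_left (isInducing_leftRightCχq p i j))

/-- `augC (inl x) = augHat x`. [cite: MochizukiEtTh2009, Def 2.1 p.36] -/
theorem augCχq_inl (x : PiHtχq p i j) : augCχq p i j (SemidirectProduct.inl x) = augHatχq p i j x :=
  SemidirectProduct.lift_inl (augHatχq p i j).toMonoidHom 1 (augHatχq_comp_hatInvActionχq p i j) x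

/-- `augC (x, z) = augHat x`. [cite: MochizukiEtTh2009, Def 2.1 p.36] -/
theorem augCχq_apply (g : PiCχq p i j) : augCχq p i j g = augHatχq p i j g.left := by
  change (augHatχq p i j).toMonoidHom g.left * (1 : Multiplicative (ZMod 2) →* GQp p) g.right = _
  rw [MonoidHom.one_apply, mul_one]
  rfl

/-! ## §2. The inhabitant of `PiCData` at `modelχq′` -/

variable (hj : Even j)

/-- **`Π_C ⊇ Π_X ↠ G_K` at the cusped stage-2 model, with the cocycle-corrected inversion** — an inhabitant of
`ThetaSetting.PiCData (ThetaSetting.modelχq′ p i j hj) (PiCχq p i j)`. [cite: MochizukiEtTh2009, Def 2.1 p.36] -/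
def piCDataχq' : (ThetaSetting.modelχq' p i j hj).PiCData (PiCχq p i j) where
  incl := ⟨SemidirectProduct.inl, Semidirect.continuous_inl (isInducing_leftRightCχq p i j)⟩
  incl_injective := SemidirectProduct.inl_injective
  range_normal := by
    change (SemidirectProduct.inl : PiHtχq p i j →* PiCχq p i j).range.Normal
    rw [SemidirectProduct.range_inl_eq_ker_rightHom]
    infer_instance
  index_range := by
    change (SemidirectProduct.inl : PiHtχq p i j →* PiCχq p i j).range.index = 2
    rw [SemidirectProduct.range_inl_eq_ker_rightHom, Subgroup.index_ker,
      MonoidHom.range_eq_top.mpr SemidirectProduct.rightHom_surjective, Subgroup.card_top]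
    change Nat.card (ZMod 2) = 2
    exact Nat.card_zmod 2
  aug := augCχq p i j
  aug_incl g := augCχq_inl p i j g
  range_aug := by
    change (augCχq p i j).toMonoidHom.range = (⊥ : IntermediateField ℚ_[p] (PadicAlgCl p)).fixingSubgroup
    rw [IntermediateField.fixingSubgroup_bot]
    refine MonoidHom.range_eq_top.mpr fun σ => ⟨SemidirectProduct.inl (SemidirectProduct.inr σ), ?_⟩
    change augCχq p i j (SemidirectProduct.inl (SemidirectProduct.inr σ)) = σ
    rw [augCχq_inl]
    rfl

/-- `incl = inl` on elements. [cite: MochizukiEtTh2009, Def 2.1 p.36] -/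
@[simp] theorem piCDataχq'_incl_apply (x : PiHtχq p i j) :
    (piCDataχq' p i j hj).incl x = SemidirectProduct.inl x := rfl

/-- `aug = augCχq`. [cite: MochizukiEtTh2009, Def 2.1 p.36] -/
theorem piCDataχq'_aug : (piCDataχq' p i j hj).aug = augCχq p i j := rfl

/-- `ε := (1, 1̄) ∈ Π_C` is GEOMETRIC and not in `Π_X`. [cite: MochizukiEtTh2009, §2 p.36] -/
theorem inr_one_mem_ker_not_mem_PiX_χq :
    (SemidirectProduct.inr (Multiplicative.ofAdd (1 : ZMod 2)) : PiCχq p i j) ∈ (piCDataχq' p i j hj).augGK.ker ∧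
      (SemidirectProduct.inr (Multiplicative.ofAdd (1 : ZMod 2)) : PiCχq p i j) ∉ (piCDataχq' p i j hj).PiX := by
  constructor
  · rw [(piCDataχq' p i j hj).mem_ker_augGK, piCDataχq'_aug, augCχq_apply, SemidirectProduct.left_inr, map_one]
  · rintro ⟨y, hy⟩
    have h := congrArg SemidirectProduct.rightHom hy
    change SemidirectProduct.rightHom (SemidirectProduct.inl y) =
      SemidirectProduct.rightHom (SemidirectProduct.inr (Multiplicative.ofAdd (1 : ZMod 2))) at h
    rw [SemidirectProduct.rightHom_inl, SemidirectProduct.rightHom_inr] at h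
    exact absurd h (by decide)

/-- **`ε · inl x · ε⁻¹ = inl (ι̂ x)`**: conjugation by `ε` IS the completed inversion. [cite: MochizukiEtTh2009, §2 p.36] -/
theorem inr_one_conj_inl_χq (x : PiHtχq p i j) :
    (SemidirectProduct.inr (Multiplicative.ofAdd (1 : ZMod 2)) : PiCχq p i j) * SemidirectProduct.inl x *
        (SemidirectProduct.inr (Multiplicative.ofAdd (1 : ZMod 2)))⁻¹ = SemidirectProduct.inl (hatInvχq p i j x) := by
  have h := SemidirectProduct.inl_aut (φ := hatInvActionχq p i j) (Multiplicative.ofAdd (1 : ZMod 2)) x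
  rw [hatInvActionχq_ofAdd_one] at h
  rw [← map_inv]
  exact h.symm

/-! ## §3. hιell / hιtheta HOLD at `piCDataχq'`; hIx FAILS -/

/-- **hιell HOLDS at `piCDataχq'` (consumer form)**: every `c ∈ Ker(Π_C ↠ G_K) ∖ Π_X` acts on `Δ̄^ell_X` by
`−1` — from `c₁ := ε` by `PiCData.inv_ell_of_one`, the pointwise clause at `ε` being the stage-2 (R1e′)
`inversionχq_hinv'`. [cite: MochizukiEtTh2009, Prop 2.2 (i) p.37] -/
theorem piCDataχq'_inv_ell (l : ℕ) (e : (ThetaSetting.modelχq' p i j hj).OncePuncturedData) :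
    ∀ c ∈ (piCDataχq' p i j hj).augGK.ker, c ∉ (piCDataχq' p i j hj).PiX →
      ∀ d ∈ (piCDataχq' p i j hj).PiX ⊓ (piCDataχq' p i j hj).augGK.ker,
        c * d * c⁻¹ * d ∈ (piCDataχq' p i j hj).barTheta l := by
  obtain ⟨hε, hεX⟩ := inr_one_mem_ker_not_mem_PiX_χq p i j hj
  refine (piCDataχq' p i j hj).inv_ell_of_one l e hε hεX fun d hd => ?_
  rw [← (piCDataχq' p i j hj).deltaX_eq e] at hd
  obtain ⟨y, hy, rfl⟩ := hd
  change (SemidirectProduct.inr (Multiplicative.ofAdd (1 : ZMod 2)) : PiCχq p i j) * SemidirectProduct.inl y *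
      (SemidirectProduct.inr (Multiplicative.ofAdd (1 : ZMod 2)))⁻¹ * SemidirectProduct.inl y ∈ _
  rw [inr_one_conj_inl_χq]
  have hmul : (SemidirectProduct.inl (hatInvχq p i j y * y) : PiCχq p i j) =
      SemidirectProduct.inl (hatInvχq p i j y) * SemidirectProduct.inl y := map_mul _ _ _
  rw [← hmul]
  refine (piCDataχq' p i j hj).map_closure_commutator_le_barTheta l ⟨hatInvχq p i j y * y, ?_, rfl⟩
  exact inversionχq_hinv' p i j y hy

/-- **hιtheta HOLDS at `piCDataχq'`** (abc-iut-L6-d6's `inv_theta_of_inv_ell`). [cite: MochizukiEtTh2009, Prop 2.2 (i) p.37] -/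
theorem piCDataχq'_inv_theta (l : ℕ) (e : (ThetaSetting.modelχq' p i j hj).OncePuncturedData) :
    ∀ c ∈ (piCDataχq' p i j hj).augGK.ker, c ∉ (piCDataχq' p i j hj).PiX →
      ∀ t ∈ (piCDataχq' p i j hj).barTheta l, c * t * c⁻¹ * t⁻¹ ∈ (piCDataχq' p i j hj).barKer l :=
  (piCDataχq' p i j hj).inv_theta_of_inv_ell l e (piCDataχq'_inv_ell p i j hj l e)

/-- **hIx FAILS at `piCDataχq'`** for every `l ≥ 2` (toral cusp: `not_inertiaClause_curveχq'` through this seat's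
`inertia_sup_barKer_iff_inertia`, compact `D_x` by `isCompact_cuspDecompχq`). [cite: MochizukiEtTh2009, Def 2.1 p.35] -/
theorem piCDataχq'_not_hIx (l : ℕ) (hl : 2 ≤ l) (e : (ThetaSetting.modelχq' p i j hj).OncePuncturedData)
    (x : (ThetaSetting.modelχq' p i j hj).Pt) :
    ¬ (((piCDataχq' p i j hj).Dx x ⊓ (piCDataχq' p i j hj).augGK.ker) ⊔ (piCDataχq' p i j hj).barKer l =
        (piCDataχq' p i j hj).barTheta l) := by
  have hcpt : IsCompact ((ThetaSetting.modelχq' p i j hj).decomp x : Set (PiTpχq p i j)) :=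
    isCompact_cuspDecompχq p i j
  rw [(piCDataχq' p i j hj).inertia_sup_barKer_iff_inertia l e x hcpt]
  exact not_inertiaClause_curveχq' p i j l hl x

/-- **CENSUS HEADLINE at stage 2.** At the cusped stage-2 model there are once-punctured parameters and a
profinite `Π_C`-bundle at which hιell and hιtheta HOLD in consumer form, a geometric element of `Π_C ∖ Π_X`
exists, and hIx FAILS — for every `l ≥ 2`. [cite: MochizukiEtTh2009, Prop 2.2 (i) p.37] -/
theorem exists_piCData_inv_ell_inv_theta_not_hIx_χq (l : ℕ) (hl : 2 ≤ l) :
    Nonempty (ThetaSetting.modelχq' p i j hj).OncePuncturedData ∧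
    ∃ I : (ThetaSetting.modelχq' p i j hj).PiCData (PiCχq p i j),
      (∀ c ∈ I.augGK.ker, c ∉ I.PiX → ∀ d ∈ I.PiX ⊓ I.augGK.ker, c * d * c⁻¹ * d ∈ I.barTheta l) ∧
      (∀ c ∈ I.augGK.ker, c ∉ I.PiX → ∀ t ∈ I.barTheta l, c * t * c⁻¹ * t⁻¹ ∈ I.barKer l) ∧
      (∃ c : PiCχq p i j, c ∈ I.augGK.ker ∧ c ∉ I.PiX) ∧
      ∀ x : (ThetaSetting.modelχq' p i j hj).Pt, ¬ ((I.Dx x ⊓ I.augGK.ker) ⊔ I.barKer l = I.barTheta l) := by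
  obtain ⟨e⟩ := nonempty_oncePuncturedData_modelχq' p i j hj
  exact ⟨⟨e⟩, piCDataχq' p i j hj, piCDataχq'_inv_ell p i j hj l e, piCDataχq'_inv_theta p i j hj l e,
    ⟨_, inr_one_mem_ker_not_mem_PiX_χq p i j hj⟩, fun x => piCDataχq'_not_hIx p i j hj l hl e x⟩

end Literature.AnabelianGeometry.EtaleTheta.SettingModel

end
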